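import Summits.QuantumFields.BalabanUV.T4Continuum.Support.VariationalColourTaxiTowerCentredEndRegular
import Summits.QuantumFields.BalabanUV.T4Continuum.Support.VariationalColourTaxiTowerProjGRateData

/-!
# T⁴ programme, spine node NE2 (U1a), lane P2 — «V-AVG-G AT TAXI DATA», file 11: THE VECTOR TOWER LIMIT AT BAŁABAN's TAXI DATA FOR THE COVARIANT PROJECTED
# GAUGE FUNCTIONAL EXISTS — FROM OPERATOR DATA: leaf-04-g7's centred END (p241220) with its four displayed decay lines DISCHARGED by file 8
# (model level; cell `pub-balaban`)

NE2 formalisation swarm `b2b-balaban-t4-ne2-formalise-*`, leaf prover 10 GEN 6 (`prover-b2b-balaban-t4-ne2-formalise-leaf-10-g6-0`, V-END holder lineage); item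
«V-AVG-G AT TAXI DATA», file 11 — the EXISTENCE junction (leaf-04-g7's «YOURS DECAY» l.23104 (3) ∕ l.23173: «with `s = t = u = u₂ = w := θ^k` your lemma closes
file 8's last four binders by `exact`»; journal NOTE l.22515, ONLINE l.24052).  Composition BY NAME of leaf-04-g7's
`VariationalColourTaxiTransport.effV_tendsto_taxiTower_projG_centred_regular` (p241220: the vector END at Bałaban's taxi data for `projG` on `ker Q_{taxi,k}`,
(ONE-min) discharged by `hONEm_taxi` ∘ `colour_leaves_taxi`, (GF3) by the regular presentation, DISPLAYING four lines of class arithmetic on explicit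
sequences `v a k ≤ ⅛`, `γ k ≤ ¼`, `ε₁ a k ≤ cε·θ^k`, `δ₁ a k ≤ cδ·θ^k` for every class sequence `a`, free `s t u u₂ w`, `θ`, `cε`, `cδ`) with file 8
`VariationalColourTaxiTowerOneMinDecay.oneMin_taxi_decay` (p243149: those sequences, at `s=t=u=u₂=w := θ^k`, obey `v ≤ V⋆`, `γ ≤ Γ⋆`, `ε₁ ≤ C_ε(Λ, C_R)·θ^k`,
`δ₁ ≤ C_δ′·θ^k` for ANY nonnegative colour constants `Λ, C_P, C_R`) and file 10 `VariationalColourTaxiTowerProjGRateData.leaf_consts_le` (this seat; the colour pair's LEVEL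
constants `Λ_k(a) ≤ Λu`, `CR_k(a) ≤ CRu`).  The one new piece of arithmetic is §1: file 8's `ε₁`-constant is MONOTONE in `(Λ, C_R)`, so the level-dependent
constant `C_ε(Λ_k(a), CR_k(a))` is bounded by the uniform `C_ε(Λu, CRu) =: Cε1`.  Nothing defined.

THE STATEMENTS.
 * §1 `oneMinConst_mono`: files 7 ∕ 7b's `E_H⋆`, `E₂⋆`, `E⋆` and file 8's `ε₁`-constant are monotone in `(Λ, C_R)` for nonnegative atoms (`gcongr`).
 * §2 **`centred_decay_lines`**: p241220's `let` telescope VERBATIM with `s = t = u = u₂ = w := θ^k` (`0 < θ ≤ 1`, `L⁻¹ ≤ θ²`) ⟹ its four displayed lines, with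
   `cε := Cε1`, `cδ := Cδ1 = √As1·DPR1` explicit k-free `let`s in `(d, L, c)` (through `lamV`, `Cst d 1`, `36^d`, and p241220's V-REG constant `CRv`), from:
   `0 ≤ b_k`, `(L^{k+1})²b_k ≤ c`, `2 ≤ L`, `1 ≤ d`, and FOUR polynomial smallness lines `hsm1`, `hsm7`, `hsmV` (`V⋆ ≤ ⅛`), `hsmG` (`Γ⋆ ≤ ¼`) — the `v` ∕ `δ₁`
   lines by file 8 directly (their constants are colour-free), the `γ` line at the class sequence `a := 0`, the `ε₁` line by file 8 ∘ §1 ∘ `leaf_consts_le`.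
 * §3 **`effV_tendsto_taxiTower_projG_of_data`** = p241220 with `s … w`, `θ`, `cε`, `cδ` and the four lines GONE (`θ₀ := (√L)⁻¹` chosen inside): **the vector
   tower limit `lim_k effV (L^k) M (Rlev k) (GmProj … ker Q_{taxi,k}) (QmL (nestLv k)) aa` EXISTS, is Hermitian with nonnegative form, and every block-spin value
   converges to its form** — from the one-step bond data (unitary, plaquette class, coherent), the DISPLAYED regular presentation `(ar_k, ℓr_k; α, λ)` of `Rlev k`,
   and NUMERIC smallness only (`hsm1`–`hsm7`, `hsmV`, `hsmG`, `hsmallδ`, `hsmallQ`).  NO (ONE-min) ∕ (GF3) ∕ V-REG ∕ colour-leaf ∕ decay-line hypothesis remains;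
   the rate twin is file 10's `towerLimitRate_effV_taxiTower_projG_of_data`.
NOT HERE: a gauge fixing producing the regular presentation (leaf-04-g8 «WILSON-LINE TOWERS» inhabits it by the lattice approximants of Lipschitz continuum
connections, non-flat included); any identification with Bałaban's (1.1)–(1.3) renormalisation flow.

HONEST FRAMING (T4-DAG p. 1).  Kernel composition at the MODEL level (finite torus, fibre `ℂ`, our discrete forms; taxi ∕ straight contours and the straight-taxi slice
OURS; [B9] (3.10)∕(3.15)∕(3.19), [B5] (1.69)–(1.70) SHAPES only; no B0, c5); [folklore] real arithmetic; nothing printed is a hypothesis.  The smallness thresholds are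
n-UNIFORM and genuine but QUANTITATIVELY VOID (memo GF3COV §3; `Cst(2,1) ≈ 1.28·10¹²`); the regular presentation is a HYPOTHESIS on the presented tower.  V-END with
background in Bałaban's flow ∕ NE2 NOT proved; NE3 OPEN; spine PROVED 0∕9 unchanged; rung (B)+1 on a fixed finite T⁴ — NOT infinite volume, NOT mass gap, NOT Clay.
No `def`, no `def … : Prop`, no `sorry`; axioms standard.  HONEST DEPENDENCY (cell, verbatim): continuum YM on T⁴ ⇐ BetaPertH ∧ nine spine estimates (0/9 proved);
BetaPertH ⇐ (D1) ∧ (D4) ∧ CAP+tail; G-an2-4 gates asym, D1 and NE2/3/4.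
-/

noncomputable section

namespace Summit.QuantumFields.BalabanUV.T4Continuum.VariationalColourTaxiTowerCentredEndData

open Filter Finset
open scoped Matrix ComplexOrder BigOperators Topology
open Literature.MathematicalPhysics.QuantumFieldTheory.Balaban1983to89.B5Prop11Plancherel (Tor fine unitVec Cst)
open Literature.Analysis.Complex (qform)
open Summit.QuantumFields.BalabanUV.T4Continuum.VariationalTransfer (blockSpin)
open Summit.QuantumFields.BalabanUV.T4Continuum.VariationalColourTower (Rtrv)
open Summit.QuantumFields.BalabanUV.T4Continuum.VariationalColourTaxiTransport
open Summit.QuantumFields.BalabanUV.T4Continuum.VectorBlockTrialForm (nsqV QvL kappaV)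
open Summit.QuantumFields.BalabanUV.T4Continuum.VariationalVectorForm (ScV lamV lamV_nonneg)
open Summit.QuantumFields.BalabanUV.T4Continuum.VariationalVectorEffective (unc effV)
open Summit.QuantumFields.BalabanUV.T4Continuum.VariationalVectorTower (QmL)
open Summit.QuantumFields.BalabanUV.T4Continuum.VariationalVectorGaugeSlice (avgOp projG)
open Summit.QuantumFields.BalabanUV.T4Continuum.VariationalVectorRegularityCovariant (GmProj)
open Summit.QuantumFields.BalabanUV.T4Continuum.CovariantBlockReversePoincare (revPC)
open Summit.QuantumFields.BalabanUV.T4Continuum.SliceComplementFlatGap (deltaGap)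
open Summit.QuantumFields.BalabanUV.T4Continuum.VariationalColourTaxiTowerOneMinDecay (oneMin_taxi_decay)
open Summit.QuantumFields.BalabanUV.T4Continuum.VariationalColourTaxiTowerProjGRateData (leaf_consts_le)

variable {d : ℕ}

/-! ## §1 The (ONE-min) rate constant is monotone in the colour pair's constants -/

/-- **MONOTONICITY OF FILE 8's `ε₁`-CONSTANT IN `(Λ, C_R)`**: file 7 ∕ 7b's starred constants `E_H⋆ ≤ E_H⋆′`, `E₂⋆ ≤ E₂⋆′`, `E⋆ ≤ E⋆′` and the `ε₁`-constant
`(1 + 2p + 8V⋆ + 8pV⋆) + A⋆E⋆ + (…)` for `0 ≤ Λ ≤ Λ′`, `0 ≤ C_R ≤ C_R′` (the other atoms fixed, nonnegative). [folklore] -/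
theorem oneMinConst_mono {d L : ℕ} {Λ Λ' CP CR CR' CRv CD CD' CD₁ CD₁' c : ℝ} (hΛ0 : 0 ≤ Λ) (hΛ : Λ ≤ Λ') (hCR0 : 0 ≤ CR) (hCR : CR ≤ CR')
    (hCP : 0 ≤ CP) (hCD : 0 ≤ CD) (hCD' : 0 ≤ CD') (hCD₁ : 0 ≤ CD₁) (hCD₁' : 0 ≤ CD₁') (hc0 : 0 ≤ c) :
    let EHs : ℝ := ((((d : ℝ) / 4 + 1 / 2) * L) * CR * (Λ + 1) + 2 * (Real.sqrt (2 * d * (1 + (d : ℝ) ^ 2)) * (L * (2 * ((d - 1 : ℕ) : ℝ) * c))) * Real.sqrt ((Λ + (((d : ℝ) / 4 + 1 / 2) * L) * CR * (Λ + 1)) * (CP * (Λ + 1))) + (Real.sqrt (2 * d * (1 + (d : ℝ) ^ 2)) * (L * (2 * ((d - 1 : ℕ) : ℝ) * c))) ^ 2 * (CP * (Λ + 1)) + 2 * (Real.sqrt d * (((d - 1 : ℕ) : ℝ) * c)) * Real.sqrt (Λ * (CP * (Λ + 1))))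
    let E2s : ℝ := (1 + 6 * ((8 * d * (CRv + (1 + (2 * ((d - 1 : ℕ) : ℝ) * c)) ^ 2 * ((d : ℝ) / 4 * L * CRv) + (2 * ((d - 1 : ℕ) : ℝ) * c) ^ 2 * ((2 * (1 + CD)) + (2 * (CD' + d * c * 64))) + 2 * (1 + (d : ℝ) ^ 2) * (L : ℝ) ^ 2 * ((2 * ((d - 1 : ℕ) : ℝ) * c) ^ 2 * (max (40 * (2 * (1 + CD))) (64 + 40 * (2 * (CD' + d * c * 64))))))) + ((d : ℝ) / 2 * (2 * d * CRv + 2 * (d : ℝ) ^ 2 * (c ^ 2 * (max (40 * (2 * (1 + CD))) (64 + 40 * (2 * (CD' + d * c * 64))))))) + ((d : ℝ) / 4 * (2 * (2 * d * CRv + 2 * (d : ℝ) ^ 2 * (c ^ 2 * (max (40 * (2 * (1 + CD))) (64 + 40 * (2 * (CD' + d * c * 64)))))) + 2 * (Λ * (CD + CD')))) + (CP * EHs * (CD + CD'))))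
    let EPSs : ℝ := (1 + 2 * ((1 + 2 * (d * (L : ℝ))) * (1 + CRv) + E2s) + 2 * ((4 * lamV d (((d - 1 : ℕ) : ℝ) * (3 * L * c)) (d : ℝ) 0) * (25 / 4 * ((2 * (1 + CD)) + (2 * (CD' + d * c * 64))))))
    let EHs' : ℝ := ((((d : ℝ) / 4 + 1 / 2) * L) * CR' * (Λ' + 1) + 2 * (Real.sqrt (2 * d * (1 + (d : ℝ) ^ 2)) * (L * (2 * ((d - 1 : ℕ) : ℝ) * c))) * Real.sqrt ((Λ' + (((d : ℝ) / 4 + 1 / 2) * L) * CR' * (Λ' + 1)) * (CP * (Λ' + 1))) + (Real.sqrt (2 * d * (1 + (d : ℝ) ^ 2)) * (L * (2 * ((d - 1 : ℕ) : ℝ) * c))) ^ 2 * (CP * (Λ' + 1)) + 2 * (Real.sqrt d * (((d - 1 : ℕ) : ℝ) * c)) * Real.sqrt (Λ' * (CP * (Λ' + 1))))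
    let E2s' : ℝ := (1 + 6 * ((8 * d * (CRv + (1 + (2 * ((d - 1 : ℕ) : ℝ) * c)) ^ 2 * ((d : ℝ) / 4 * L * CRv) + (2 * ((d - 1 : ℕ) : ℝ) * c) ^ 2 * ((2 * (1 + CD)) + (2 * (CD' + d * c * 64))) + 2 * (1 + (d : ℝ) ^ 2) * (L : ℝ) ^ 2 * ((2 * ((d - 1 : ℕ) : ℝ) * c) ^ 2 * (max (40 * (2 * (1 + CD))) (64 + 40 * (2 * (CD' + d * c * 64))))))) + ((d : ℝ) / 2 * (2 * d * CRv + 2 * (d : ℝ) ^ 2 * (c ^ 2 * (max (40 * (2 * (1 + CD))) (64 + 40 * (2 * (CD' + d * c * 64))))))) + ((d : ℝ) / 4 * (2 * (2 * d * CRv + 2 * (d : ℝ) ^ 2 * (c ^ 2 * (max (40 * (2 * (1 + CD))) (64 + 40 * (2 * (CD' + d * c * 64)))))) + 2 * (Λ' * (CD + CD')))) + (CP * EHs' * (CD + CD'))))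
    let EPSs' : ℝ := (1 + 2 * ((1 + 2 * (d * (L : ℝ))) * (1 + CRv) + E2s') + 2 * ((4 * lamV d (((d - 1 : ℕ) : ℝ) * (3 * L * c)) (d : ℝ) 0) * (25 / 4 * ((2 * (1 + CD)) + (2 * (CD' + d * c * 64))))))
    let Vs : ℝ := (2 * ((4 * ((d : ℝ) * ((d : ℝ) * c)) * (4 * d * (36 : ℝ) ^ d * (1 + 3 * ((d - 1 : ℕ) : ℝ) * L * c) ^ 2)) ^ 2 * ((d : ℝ) * ((2 * (1 + CD₁)) + (2 * (CD₁' + d * c * 64))))))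
    let Gs : ℝ := ((3 * (((d - 1 : ℕ) : ℝ) * c)) ^ 2 * (max (40 * (2 * (1 + CD₁))) (64 + 40 * (2 * (CD₁' + d * c * 64)))))
    let p : ℝ := (1 + 2 * ((4 * lamV d (((d - 1 : ℕ) : ℝ) * c) (d : ℝ) 0) * Gs) * (1 + 4 * Gs))
    let As : ℝ := (1 + p) * (1 + 4 * Vs) * 2
    (1 + 2 * p + 8 * Vs + 8 * p * Vs) + As * EPSs + (4 * Vs * ((1 + p) * (1 + 4 * Vs)) + 8 * ((4 * lamV d (((d - 1 : ℕ) : ℝ) * c) (d : ℝ) 0) * Gs))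
      ≤ (1 + 2 * p + 8 * Vs + 8 * p * Vs) + As * EPSs' + (4 * Vs * ((1 + p) * (1 + 4 * Vs)) + 8 * ((4 * lamV d (((d - 1 : ℕ) : ℝ) * c) (d : ℝ) 0) * Gs)) := by
  intro EHs E2s EPSs EHs' E2s' EPSs' Vs Gs p As
  have hd0 : (0 : ℝ) ≤ d := Nat.cast_nonneg d
  have hL0 : (0 : ℝ) ≤ L := Nat.cast_nonneg L
  have hD0 : (0 : ℝ) ≤ ((d - 1 : ℕ) : ℝ) := Nat.cast_nonneg _
  have hΛ'0 : 0 ≤ Λ' := hΛ0.trans hΛ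
  have hCR'0 : 0 ≤ CR' := hCR0.trans hCR
  have hEH0 : 0 ≤ EHs := by
    show 0 ≤ ((((d : ℝ) / 4 + 1 / 2) * L) * CR * (Λ + 1) + 2 * (Real.sqrt (2 * d * (1 + (d : ℝ) ^ 2)) * (L * (2 * ((d - 1 : ℕ) : ℝ) * c))) * Real.sqrt ((Λ + (((d : ℝ) / 4 + 1 / 2) * L) * CR * (Λ + 1)) * (CP * (Λ + 1))) + (Real.sqrt (2 * d * (1 + (d : ℝ) ^ 2)) * (L * (2 * ((d - 1 : ℕ) : ℝ) * c))) ^ 2 * (CP * (Λ + 1)) + 2 * (Real.sqrt d * (((d - 1 : ℕ) : ℝ) * c)) * Real.sqrt (Λ * (CP * (Λ + 1))))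
    positivity
  have h1 : EHs ≤ EHs' := by
    show ((((d : ℝ) / 4 + 1 / 2) * L) * CR * (Λ + 1) + 2 * (Real.sqrt (2 * d * (1 + (d : ℝ) ^ 2)) * (L * (2 * ((d - 1 : ℕ) : ℝ) * c))) * Real.sqrt ((Λ + (((d : ℝ) / 4 + 1 / 2) * L) * CR * (Λ + 1)) * (CP * (Λ + 1))) + (Real.sqrt (2 * d * (1 + (d : ℝ) ^ 2)) * (L * (2 * ((d - 1 : ℕ) : ℝ) * c))) ^ 2 * (CP * (Λ + 1)) + 2 * (Real.sqrt d * (((d - 1 : ℕ) : ℝ) * c)) * Real.sqrt (Λ * (CP * (Λ + 1))))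
      ≤ ((((d : ℝ) / 4 + 1 / 2) * L) * CR' * (Λ' + 1) + 2 * (Real.sqrt (2 * d * (1 + (d : ℝ) ^ 2)) * (L * (2 * ((d - 1 : ℕ) : ℝ) * c))) * Real.sqrt ((Λ' + (((d : ℝ) / 4 + 1 / 2) * L) * CR' * (Λ' + 1)) * (CP * (Λ' + 1))) + (Real.sqrt (2 * d * (1 + (d : ℝ) ^ 2)) * (L * (2 * ((d - 1 : ℕ) : ℝ) * c))) ^ 2 * (CP * (Λ' + 1)) + 2 * (Real.sqrt d * (((d - 1 : ℕ) : ℝ) * c)) * Real.sqrt (Λ' * (CP * (Λ' + 1))))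
    gcongr
  have hEH0' : 0 ≤ EHs' := hEH0.trans h1
  have hmax : 0 ≤ max (40 * (2 * (1 + CD))) (64 + 40 * (2 * (CD' + d * c * 64))) := le_max_of_le_left (by positivity)
  have h2 : E2s ≤ E2s' := by
    show (1 + 6 * ((8 * d * (CRv + (1 + (2 * ((d - 1 : ℕ) : ℝ) * c)) ^ 2 * ((d : ℝ) / 4 * L * CRv) + (2 * ((d - 1 : ℕ) : ℝ) * c) ^ 2 * ((2 * (1 + CD)) + (2 * (CD' + d * c * 64))) + 2 * (1 + (d : ℝ) ^ 2) * (L : ℝ) ^ 2 * ((2 * ((d - 1 : ℕ) : ℝ) * c) ^ 2 * (max (40 * (2 * (1 + CD))) (64 + 40 * (2 * (CD' + d * c * 64))))))) + ((d : ℝ) / 2 * (2 * d * CRv + 2 * (d : ℝ) ^ 2 * (c ^ 2 * (max (40 * (2 * (1 + CD))) (64 + 40 * (2 * (CD' + d * c * 64))))))) + ((d : ℝ) / 4 * (2 * (2 * d * CRv + 2 * (d : ℝ) ^ 2 * (c ^ 2 * (max (40 * (2 * (1 + CD))) (64 + 40 * (2 * (CD' + d * c * 64)))))) + 2 * (Λ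 * (CD + CD')))) + (CP * EHs * (CD + CD'))))
      ≤ (1 + 6 * ((8 * d * (CRv + (1 + (2 * ((d - 1 : ℕ) : ℝ) * c)) ^ 2 * ((d : ℝ) / 4 * L * CRv) + (2 * ((d - 1 : ℕ) : ℝ) * c) ^ 2 * ((2 * (1 + CD)) + (2 * (CD' + d * c * 64))) + 2 * (1 + (d : ℝ) ^ 2) * (L : ℝ) ^ 2 * ((2 * ((d - 1 : ℕ) : ℝ) * c) ^ 2 * (max (40 * (2 * (1 + CD))) (64 + 40 * (2 * (CD' + d * c * 64))))))) + ((d : ℝ) / 2 * (2 * d * CRv + 2 * (d : ℝ) ^ 2 * (c ^ 2 * (max (40 * (2 * (1 + CD))) (64 + 40 * (2 * (CD' + d * c * 64))))))) + ((d : ℝ) / 4 * (2 * (2 * d * CRv + 2 * (d : ℝ) ^ 2 * (c ^ 2 * (max (40 * (2 * (1 + CD))) (64 + 40 * (2 * (CD' + d * c * 64)))))) + 2 * (Λ' * (CD + CD')))) + (CP * EHs' * (CD + CD'))))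
    gcongr
  have hl3 : 0 ≤ lamV d (((d - 1 : ℕ) : ℝ) * (3 * L * c)) (d : ℝ) 0 := lamV_nonneg hd0 le_rfl
  have h3 : EPSs ≤ EPSs' := by
    show (1 + 2 * ((1 + 2 * (d * (L : ℝ))) * (1 + CRv) + E2s) + 2 * ((4 * lamV d (((d - 1 : ℕ) : ℝ) * (3 * L * c)) (d : ℝ) 0) * (25 / 4 * ((2 * (1 + CD)) + (2 * (CD' + d * c * 64))))))
      ≤ (1 + 2 * ((1 + 2 * (d * (L : ℝ))) * (1 + CRv) + E2s') + 2 * ((4 * lamV d (((d - 1 : ℕ) : ℝ) * (3 * L * c)) (d : ℝ) 0) * (25 / 4 * ((2 * (1 + CD)) + (2 * (CD' + d * c * 64))))))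
    gcongr
  have hVs : 0 ≤ Vs := by
    show 0 ≤ (2 * ((4 * ((d : ℝ) * ((d : ℝ) * c)) * (4 * d * (36 : ℝ) ^ d * (1 + 3 * ((d - 1 : ℕ) : ℝ) * L * c) ^ 2)) ^ 2 * ((d : ℝ) * ((2 * (1 + CD₁)) + (2 * (CD₁' + d * c * 64))))))
    positivity
  have hmax₁ : 0 ≤ max (40 * (2 * (1 + CD₁))) (64 + 40 * (2 * (CD₁' + d * c * 64))) := le_max_of_le_left (by positivity)
  have hGs : 0 ≤ Gs := by
    show 0 ≤ ((3 * (((d - 1 : ℕ) : ℝ) * c)) ^ 2 * (max (40 * (2 * (1 + CD₁))) (64 + 40 * (2 * (CD₁' + d * c * 64)))))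
    exact mul_nonneg (sq_nonneg _) hmax₁
  have hl1 : 0 ≤ lamV d (((d - 1 : ℕ) : ℝ) * c) (d : ℝ) 0 := lamV_nonneg hd0 le_rfl
  have hp : 0 ≤ p := by
    show 0 ≤ (1 + 2 * ((4 * lamV d (((d - 1 : ℕ) : ℝ) * c) (d : ℝ) 0) * Gs) * (1 + 4 * Gs))
    positivity
  have hAs : 0 ≤ As := by
    show 0 ≤ (1 + p) * (1 + 4 * Vs) * 2
    positivity
  gcongr

/-! ## §2 The centred END's four displayed lines -/

section Taxi

variable (L : ℕ) [NeZero L] (M : Fin d → ℕ) [hM : ∀ μ, NeZero (M μ)]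

omit [NeZero L] hM in
/-- **THE FOUR DISPLAYED DECAY LINES OF p241220 HOLD UNDER THE CLASS** — its `let` telescope verbatim with `s = t = u = u₂ = w := θ^k`; `cε := Cε1`, `cδ := Cδ1`. [folklore] -/
theorem centred_decay_lines (hL : 2 ≤ L) (hd : 1 ≤ d) {b : ℕ → ℝ} {c : ℝ} (hb0 : ∀ k, 0 ≤ b k)
    (hbc : ∀ k, (((L ^ (k + 1) : ℕ)) : ℝ) ^ 2 * b k ≤ c)
    (hsm1 : 60 * (6 : ℝ) ^ (d - 1) * ((2 * ((((d - 1 : ℕ) : ℝ) + (d : ℝ) * d)) + 3 * ((d - 1 : ℕ) : ℝ)) * c) ≤ 1 / 2)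
    (hsm7 : 60 * (6 : ℝ) ^ (d - 1) * ((2 * ((((d - 1 : ℕ) : ℝ)) + (d : ℝ) * d) + 5 * ((d - 1 : ℕ) : ℝ)) * c) ≤ 1 / 2)
    (hsmV : (2 * ((4 * ((d : ℝ) * ((d : ℝ) * c)) * (4 * d * (36 : ℝ) ^ d * (1 + 3 * ((d - 1 : ℕ) : ℝ) * L * c) ^ 2)) ^ 2 * ((d : ℝ) * ((2 * (1 + (36 * (d * ((d + 1 : ℝ) * Cst d 1)) + 8))) + (2 * ((24 * (d * ((d + 1 : ℝ) * Cst d 1)) + 4) + d * c * 64)))))) ≤ 1 / 8)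
    (hsmG : ((3 * (((d - 1 : ℕ) : ℝ) * c)) ^ 2 * (max (40 * (2 * (1 + (36 * (d * ((d + 1 : ℝ) * Cst d 1)) + 8)))) (64 + 40 * (2 * ((24 * (d * ((d + 1 : ℝ) * Cst d 1)) + 4) + d * c * 64))))) ≤ 1 / 4)
    {θ : ℝ} (hθ0 : 0 < θ) (hθL : (L : ℝ)⁻¹ ≤ θ ^ 2) (hθ1 : θ ≤ 1) :
    -- the colour scalar pair's constants at the taxi frames (file 7's lets, `C_P = 136`)
    let Λc : (ℕ → ℝ) → ℕ → ℝ := fun a k => 2 * d * (36 : ℝ) ^ d * ((1 + ((L ^ k : ℕ) : ℝ) * (((d - 1 : ℕ) : ℝ) * ((L ^ k - 1 : ℕ) : ℝ) * a k)) ^ 2 + 9)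
    let CRc : (ℕ → ℝ) → ℕ → ℝ := fun a k => 2 * Λc a k + 2 * d * (a k * (((L ^ k : ℕ) : ℝ)) ^ 2) + (d : ℝ) ^ 2 * (a k * (((L ^ k : ℕ) : ℝ)) ^ 2) ^ 2 * 136
    let ε₁c : ℕ → ℝ := fun k => ((d : ℝ) / 4 + 1 / 2) * ((L : ℝ) / (((L ^ k : ℕ) : ℝ)) ^ 2)
    let δ'c : ℕ → ℝ := fun k => Real.sqrt (2 * d * (1 + (d : ℝ) ^ 2)) * ((((L ^ k : ℕ) : ℝ)) * L * (((d - 1 : ℕ) : ℝ) * ((L - 1 : ℕ) : ℝ) * ((2 * L - 1 : ℕ) : ℝ) * b k))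
    let Λcol : (ℕ → ℝ) → ℕ → ℝ := fun a k => Λc a k + (ε₁c k * CRc a k + 2 * δ'c k * Real.sqrt ((1 + ε₁c k * CRc a k) * 136) + δ'c k ^ 2 * 136) * (Λc a k + 1)
    -- part 6 §1's V-P ∕ (Går) constants from part 7's (GF3) constants `36d(d+1)Cst+8`, `24d(d+1)Cst+4`, file 5's `Λᵥ`, part 8's V-REG constant
    let CPv : (ℕ → ℝ) → ℕ → ℝ := fun a k => max (40 * (2 * (1 + (36 * (d * ((d + 1 : ℝ) * Cst d 1)) + 8)))) (64 + 40 * (2 * ((24 * (d * ((d + 1 : ℝ) * Cst d 1)) + 4) + d * ((((L ^ k : ℕ) : ℝ)) ^ 2 * a k) * 64)))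
    let CGar' : (ℕ → ℝ) → ℕ → ℝ := fun a k => 2 * ((24 * (d * ((d + 1 : ℝ) * Cst d 1)) + 4) + d * ((((L ^ k : ℕ) : ℝ)) ^ 2 * a k) * 64)
    let Λv : (ℕ → ℝ) → ℕ → ℝ := fun a k => lamV d ((L ^ k * L : ℕ) * (((d - 1 : ℕ) : ℝ) * ((L - 1 : ℕ) : ℝ) * ((2 * L - 1 : ℕ) : ℝ) * b k + ((d - 1 : ℕ) : ℝ) * ((L ^ k - 1 : ℕ) : ℝ) * a k)) d (((L ^ k * L : ℕ) : ℝ) ^ 2 * 0)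
          / (1 - (kappaV d (L ^ k * L))⁻¹ * ((∑ q ∈ Finset.range k, ((((d - 1 : ℕ) : ℝ) + (d : ℝ) * d) * (((L : ℝ) * ((L ^ q - 1 : ℕ) : ℝ) * ((L - 1 : ℕ) : ℝ)) * b q))) + 3 * (((d - 1 : ℕ) : ℝ) * (L ^ k : ℕ) * ((L ^ k - 1 : ℕ) : ℝ) * a k) + ((d - 1 : ℕ) : ℝ) * ((L ^ k - 1 : ℕ) : ℝ) * ((2 * L ^ k - 1 : ℕ) : ℝ) * a k)) ^ 2
    let CRv : ℝ := (8 * (4 * lamV d (((d - 1 : ℕ) : ℝ) * c) (d : ℝ) 0) + 2 * d * c * ((2 * (1 + (36 * (d * ((d + 1 : ℝ) * Cst d 1)) + 8))) + (2 * ((24 * (d * ((d + 1 : ℝ) * Cst d 1)) + 4) + (d : ℝ) * c * 64))) + (8 * (4 * d * 36 ^ d * (1 + ((d - 1 : ℕ) : ℝ) * c) ^ 2) ^ 2 + 5 * (d : ℝ) ^ 2 * c ^ 2) * (max (40 * (2 * (1 + (36 * (d * ((d + 1 : ℝ) * Cst d 1)) + 8)))) (64 + 40 * (2 * ((24 * (d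 * ((d + 1 : ℝ) * Cst d 1)) + 4) + (d : ℝ) * c * 64)))))
    -- leaf-01-g9's `eH`, `e₂`, `ε⋆` at the taxi sizes, and `δ′`
    let eH : (ℕ → ℝ) → ℕ → ℝ := fun a k => (((d : ℝ) / 4 + 1 / 2) * ((L : ℝ) / ((L ^ k : ℕ) : ℝ) ^ 2)) * CRc a k * (Λcol a k + 1)
        + 2 * (Real.sqrt (2 * d * (1 + (d : ℝ) ^ 2)) * (((L ^ k : ℕ) : ℝ) * L * (((d - 1 : ℕ) : ℝ) * ((L - 1 : ℕ) : ℝ) * ((2 * L - 1 : ℕ) : ℝ) * b k)))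
          * Real.sqrt ((Λcol a k + (((d : ℝ) / 4 + 1 / 2) * ((L : ℝ) / ((L ^ k : ℕ) : ℝ) ^ 2)) * CRc a k * (Λcol a k + 1)) * (136 * (Λcol a k + 1)))
        + (Real.sqrt (2 * d * (1 + (d : ℝ) ^ 2)) * (((L ^ k : ℕ) : ℝ) * L * (((d - 1 : ℕ) : ℝ) * ((L - 1 : ℕ) : ℝ) * ((2 * L - 1 : ℕ) : ℝ) * b k))) ^ 2 * (136 * (Λcol a k + 1))
        + 2 * (Real.sqrt d * (((L ^ k : ℕ) : ℝ) * (((d - 1 : ℕ) : ℝ) * L * ((L - 1 : ℕ) : ℝ) * b k))) * Real.sqrt (Λcol a k * (136 * (Λcol a k + 1)))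
    let e₂ : (ℕ → ℝ) → ℕ → ℝ := fun a k => θ ^ k + 3 * (1 + (θ ^ k)⁻¹) * (8 * d * ((((L ^ k : ℕ) : ℝ) ^ 2)⁻¹ * CRv
          + (1 + (((d - 1 : ℕ) : ℝ) * ((L - 1 : ℕ) : ℝ) * ((2 * L - 1 : ℕ) : ℝ) * b k)) ^ 2 * ((d : ℝ) / 4 * L * ((((L ^ k : ℕ) : ℝ) ^ 2)⁻¹ * CRv)) + (((d - 1 : ℕ) : ℝ) * ((L - 1 : ℕ) : ℝ) * ((2 * L - 1 : ℕ) : ℝ) * b k) ^ 2 * ((2 * (1 + (36 * (d * ((d + 1 : ℝ) * Cst d 1)) + 8))) + CGar' a k)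
          + (((d - 1 : ℕ) : ℝ) * ((L - 1 : ℕ) : ℝ) * ((2 * L - 1 : ℕ) : ℝ) * b k) ^ 2 * (2 * (1 + (d : ℝ) ^ 2) * (L : ℝ) ^ 2 * (((L ^ k : ℕ) : ℝ) ^ 2 * CPv a k)))
        + (d : ℝ) / 2 * (2 * d * ((((L ^ k : ℕ) : ℝ) ^ 2)⁻¹ * CRv) + 2 * (d : ℝ) ^ 2 * a k ^ 2 * (((L ^ k : ℕ) : ℝ) ^ 2 * CPv a k))
        + (d : ℝ) / 4 * (2 * (2 * d * ((((L ^ k : ℕ) : ℝ) ^ 2)⁻¹ * CRv) + 2 * (d : ℝ) ^ 2 * a k ^ 2 * (((L ^ k : ℕ) : ℝ) ^ 2 * CPv a k)) + 2 * (Λcol a k * (((L ^ k : ℕ) : ℝ) ^ 2)⁻¹ * ((36 * (d * ((d + 1 : ℝ) * Cst d 1)) + 8) + (24 * (d * ((d + 1 : ℝ) * Cst d 1)) + 4))))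
        + 136 * eH a k * ((36 * (d * ((d + 1 : ℝ) * Cst d 1)) + 8) + (24 * (d * ((d + 1 : ℝ) * Cst d 1)) + 4)))
    let εs : (ℕ → ℝ) → ℕ → ℝ := fun a k => θ ^ k + (1 + θ ^ k) * ((θ ^ k + (1 + (θ ^ k)⁻¹) * (d * (L : ℝ) / ((L ^ k : ℕ) : ℝ) ^ 2)) * (1 + CRv) + e₂ a k)
      + (1 + (θ ^ k)⁻¹) * (Λv a k * (25 / 4 * ((((L ^ k : ℕ) : ℝ) ^ 2)⁻¹ * ((2 * (1 + (36 * (d * ((d + 1 : ℝ) * Cst d 1)) + 8))) + CGar' a k))))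
    let δ' : ℕ → ℝ := fun k => Real.sqrt (8 * d * (1 + (d : ℝ) ^ 2)) * (((L ^ k : ℕ) : ℝ) * L * (((d - 1 : ℕ) : ℝ) * ((L - 1 : ℕ) : ℝ) * ((2 * L - 1 : ℕ) : ℝ) * b k))
    -- file 4b's transfer constants
    let v : (ℕ → ℝ) → ℕ → ℝ := fun a k => (1 + (θ ^ k)⁻¹) * (4 * ((d : ℝ) * ((d : ℝ) * (((L : ℝ) * ((L ^ k - 1 : ℕ) : ℝ) * ((L - 1 : ℕ) : ℝ)) * b k)))
          * revPC d (L ^ k * L) (((d - 1 : ℕ) : ℝ) * ((L - 1 : ℕ) : ℝ) * ((2 * L - 1 : ℕ) : ℝ) * b k + ((d - 1 : ℕ) : ℝ) * ((L ^ k - 1 : ℕ) : ℝ) * a k)) ^ 2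
        * ((d : ℝ) * ((2 * (1 + (36 * (d * ((d + 1 : ℝ) * Cst d 1)) + 8))) + (2 * ((24 * (d * ((d + 1 : ℝ) * Cst d 1)) + 4) + d * ((((L ^ (k + 1) : ℕ) : ℝ)) ^ 2 * b k) * 64))))
    let γ : ℕ → ℝ := fun k => (3 * (((d - 1 : ℕ) : ℝ) * L * ((L - 1 : ℕ) : ℝ) * b k)) ^ 2 * max (40 * (2 * (1 + (36 * (d * ((d + 1 : ℝ) * Cst d 1)) + 8)))) (64 + 40 * (2 * ((24 * (d * ((d + 1 : ℝ) * Cst d 1)) + 4) + d * ((((L ^ (k + 1) : ℕ) : ℝ)) ^ 2 * b k) * 64)))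
    let Λf : ℕ → ℝ := fun k => lamV d ((L ^ (k + 1) : ℕ) * (((d - 1 : ℕ) : ℝ) * ((L ^ (k + 1) - 1 : ℕ) : ℝ) * b k)) d (((L ^ (k + 1) : ℕ) : ℝ) ^ 2 * 0)
          / (1 - (kappaV d (L ^ (k + 1)))⁻¹ * ((∑ q ∈ Finset.range (k + 1), ((((d - 1 : ℕ) : ℝ) + (d : ℝ) * d) * (((L : ℝ) * ((L ^ q - 1 : ℕ) : ℝ) * ((L - 1 : ℕ) : ℝ)) * b q)))
              + 3 * (((d - 1 : ℕ) : ℝ) * (L ^ (k + 1) : ℕ) * ((L ^ (k + 1) - 1 : ℕ) : ℝ) * b k))) ^ 2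
    let A : (ℕ → ℝ) → ℕ → ℝ := fun a k => (1 + θ ^ k + (1 + (θ ^ k)⁻¹) * (Λf k * γ k) * (1 + 4 * γ k)) * (1 + 4 * v a k) * (1 + θ ^ k)
    let B : (ℕ → ℝ) → ℕ → ℝ := fun a k => (1 + θ ^ k + (1 + (θ ^ k)⁻¹) * (Λf k * γ k) * (1 + 4 * γ k)) * (1 + 4 * v a k) * (4 * v a k) + 4 * ((1 + (θ ^ k)⁻¹) * (Λf k * γ k))
    -- the END's decaying defects
    let ε₁ : (ℕ → ℝ) → ℕ → ℝ := fun a k => (A a k - 1) + A a k * εs a k + B a k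
    let δ₁ : (ℕ → ℝ) → ℕ → ℝ := fun a k => Real.sqrt (A a k) * δ' k
    -- the colour scalar pair's UNIFORM constants at the taxi frames (file 10's `Λu`, `CRu`; `C_P = 136`) and part 7's (GF3) constants
    let Λcu : ℝ := 2 * d * (36 : ℝ) ^ d * ((1 + ((d - 1 : ℕ) : ℝ) * c) ^ 2 + 9)
    let CRu : ℝ := 2 * Λcu + 2 * d * c + (d : ℝ) ^ 2 * c ^ 2 * 136
    let ε₁u : ℝ := ((d : ℝ) / 4 + 1 / 2) * L
    let δ'u : ℝ := Real.sqrt (2 * d * (1 + (d : ℝ) ^ 2)) * (2 * ((d - 1 : ℕ) : ℝ) * L * c)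
    let Λu : ℝ := Λcu + (ε₁u * CRu + 2 * δ'u * Real.sqrt ((1 + ε₁u * CRu) * 136) + δ'u ^ 2 * 136) * (Λcu + 1)
    let CDs : ℝ := 36 * (d * ((d + 1 : ℝ) * Cst d 1)) + 8
    let CDs' : ℝ := 24 * (d * ((d + 1 : ℝ) * Cst d 1)) + 4
    -- files 7 ∕ 7b ∕ 8's (ONE-min) decay constants at (`Λu`, `136`, `CRu`, `CRv`, `CDs`, `CDs′`)
    let EH1 : ℝ := ((((d : ℝ) / 4 + 1 / 2) * L) * CRu * (Λu + 1) + 2 * (Real.sqrt (2 * d * (1 + (d : ℝ) ^ 2)) * (L * (2 * ((d - 1 : ℕ) : ℝ) * c))) * Real.sqrt ((Λu + (((d : ℝ) / 4 + 1 / 2) * L) * CRu * (Λu + 1)) * ((136 : ℝ) * (Λu + 1))) + (Real.sqrt (2 * d * (1 + (d : ℝ) ^ 2)) * (L * (2 * ((d - 1 : ℕ) : ℝ) * c))) ^ 2 * ((136 : ℝ) * (Λu + 1)) + 2 * (Real.sqrt d * (((d - 1 : ℕ) : ℝ) * c)) * Real.sqrt (Λu * ((136 : ℝ) * (Λu + 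1))))
    let E21 : ℝ := (1 + 6 * ((8 * d * (CRv + (1 + (2 * ((d - 1 : ℕ) : ℝ) * c)) ^ 2 * ((d : ℝ) / 4 * L * CRv) + (2 * ((d - 1 : ℕ) : ℝ) * c) ^ 2 * ((2 * (1 + CDs)) + (2 * (CDs' + d * c * 64))) + 2 * (1 + (d : ℝ) ^ 2) * (L : ℝ) ^ 2 * ((2 * ((d - 1 : ℕ) : ℝ) * c) ^ 2 * (max (40 * (2 * (1 + CDs))) (64 + 40 * (2 * (CDs' + d * c * 64))))))) + ((d : ℝ) / 2 * (2 * d * CRv + 2 * (d : ℝ) ^ 2 * (c ^ 2 * (max (40 * (2 * (1 + CDs))) (64 + 40 * (2 * (CDs' + d * c * 64))))))) + ((d : ℝ) / 4 * (2 * (2 * d * CRv + 2 * (d : ℝ) ^ 2 * (c ^ 2 * (max (40 * (2 * (1 + CDs))) (64 + 40 * (2 * (CDs' + d * c * 64)))))) + 2 * (Λu * (CDs + CDs')))) + ((136 : ℝ) * EH1 * (CDs + CDs'))))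
    let EPS1 : ℝ := (1 + 2 * ((1 + 2 * (d * (L : ℝ))) * (1 + CRv) + E21) + 2 * ((4 * lamV d (((d - 1 : ℕ) : ℝ) * (3 * L * c)) (d : ℝ) 0) * (25 / 4 * ((2 * (1 + CDs)) + (2 * (CDs' + d * c * 64))))))
    let V1 : ℝ := (2 * ((4 * ((d : ℝ) * ((d : ℝ) * c)) * (4 * d * (36 : ℝ) ^ d * (1 + 3 * ((d - 1 : ℕ) : ℝ) * L * c) ^ 2)) ^ 2 * ((d : ℝ) * ((2 * (1 + CDs)) + (2 * (CDs' + d * c * 64))))))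
    let G1 : ℝ := ((3 * (((d - 1 : ℕ) : ℝ) * c)) ^ 2 * (max (40 * (2 * (1 + CDs))) (64 + 40 * (2 * (CDs' + d * c * 64)))))
    let DPR1 : ℝ := (Real.sqrt (8 * d * (1 + (d : ℝ) ^ 2)) * (L * (2 * ((d - 1 : ℕ) : ℝ) * c)))
    let p1 : ℝ := (1 + 2 * ((4 * lamV d (((d - 1 : ℕ) : ℝ) * c) (d : ℝ) 0) * G1) * (1 + 4 * G1))
    let As1 : ℝ := (1 + p1) * (1 + 4 * V1) * 2
    let Cε1 : ℝ := (1 + 2 * p1 + 8 * V1 + 8 * p1 * V1) + As1 * EPS1 + (4 * V1 * ((1 + p1) * (1 + 4 * V1)) + 8 * ((4 * lamV d (((d - 1 : ℕ) : ℝ) * c) (d : ℝ) 0) * G1))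
    let Cδ1 : ℝ := Real.sqrt As1 * DPR1
    (∀ a : ℕ → ℝ, (∀ k, 0 ≤ a k) → (∀ k, (((L ^ k : ℕ)) : ℝ) ^ 2 * a k ≤ c) → ∀ k, v a k ≤ 1 / 8) ∧
    (∀ k, γ k ≤ 1 / 4) ∧
    (∀ a : ℕ → ℝ, (∀ k, 0 ≤ a k) → (∀ k, (((L ^ k : ℕ)) : ℝ) ^ 2 * a k ≤ c) → ∀ k, ε₁ a k ≤ Cε1 * θ ^ k) ∧
    (∀ a : ℕ → ℝ, (∀ k, 0 ≤ a k) → (∀ k, (((L ^ k : ℕ)) : ℝ) ^ 2 * a k ≤ c) → ∀ k, δ₁ a k ≤ Cδ1 * θ ^ k) := by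
  intro Λc CRc ε₁c δ'c Λcol CPv CGar' Λv CRv eH e₂ εs δ' v γ Λf A B ε₁ δ₁ Λcu CRu ε₁u δ'u Λu CDs CDs' EH1 E21 EPS1 V1 G1 DPR1 p1 As1 Cε1 Cδ1
  have hL1 : 1 ≤ L := le_trans (by norm_num) hL
  have hd0 : (0 : ℝ) ≤ d := Nat.cast_nonneg d
  have hL0 : (0 : ℝ) ≤ L := Nat.cast_nonneg L
  have hD0 : (0 : ℝ) ≤ ((d - 1 : ℕ) : ℝ) := Nat.cast_nonneg _
  have hc0 : 0 ≤ c := le_trans (by have := hb0 0; positivity) (hbc 0)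
  -- part 7's (GF3) constants are nonnegative (`1 ≤ Cst d 1`)
  have hC1 : (1 : ℝ) ≤ Cst d 1 := Literature.MathematicalPhysics.QuantumFieldTheory.Balaban1983to89.B5Prop11Lower.one_le_Cst (d := d) (1 : ℝ)
  have hC0 : (0 : ℝ) ≤ d * ((d + 1 : ℝ) * Cst d 1) :=
    mul_nonneg hd0 (mul_nonneg (by exact_mod_cast Nat.zero_le (d + 1)) (zero_le_one.trans hC1))
  have hCf0 : (0 : ℝ) ≤ 36 * (d * ((d + 1 : ℝ) * Cst d 1)) + 8 := add_nonneg (mul_nonneg (by norm_num : (0 : ℝ) ≤ 36) hC0) (by norm_num : (0 : ℝ) ≤ 8)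
  have hCf0' : (0 : ℝ) ≤ 24 * (d * ((d + 1 : ℝ) * Cst d 1)) + 4 := add_nonneg (mul_nonneg (by norm_num : (0 : ℝ) ≤ 24) hC0) (by norm_num : (0 : ℝ) ≤ 4)
  -- part 8's V-REG constant is nonnegative
  have hl1 : 0 ≤ lamV d (((d - 1 : ℕ) : ℝ) * c) (d : ℝ) 0 := lamV_nonneg hd0 le_rfl
  have hκs0 : (0 : ℝ) ≤ 2 * (1 + (36 * (d * ((d + 1 : ℝ) * Cst d 1)) + 8)) := mul_nonneg zero_le_two (add_nonneg zero_le_one hCf0)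
  have hκs0' : (0 : ℝ) ≤ 2 * ((24 * (d * ((d + 1 : ℝ) * Cst d 1)) + 4) + (d : ℝ) * c * 64) := mul_nonneg zero_le_two (add_nonneg hCf0' (by positivity))
  have hCPs0 : (0 : ℝ) ≤ max (40 * (2 * (1 + (36 * (d * ((d + 1 : ℝ) * Cst d 1)) + 8)))) (64 + 40 * (2 * ((24 * (d * ((d + 1 : ℝ) * Cst d 1)) + 4) + (d : ℝ) * c * 64))) :=
    le_max_of_le_left (mul_nonneg (by norm_num) hκs0)
  have hCRv0 : 0 ≤ CRv :=
    add_nonneg (add_nonneg (mul_nonneg (by norm_num) (mul_nonneg (by norm_num) hl1)) (mul_nonneg (mul_nonneg (mul_nonneg zero_le_two hd0) hc0) (add_nonneg hκs0 hκs0')))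
      (mul_nonneg (add_nonneg (mul_nonneg (by norm_num) (sq_nonneg _)) (by positivity)) hCPs0)
  -- file 8 at level `k` for a class sequence `a`, the colour pair's constants := file 7's level constants (`C_P = 136`)
  have key : ∀ a : ℕ → ℝ, (∀ k, 0 ≤ a k) → (∀ k, (((L ^ k : ℕ)) : ℝ) ^ 2 * a k ≤ c) → ∀ k,
      0 ≤ Λcol a k ∧ Λcol a k ≤ Λu ∧ 0 ≤ CRc a k ∧ CRc a k ≤ CRu := fun a ha0 hac k => by
    have h := leaf_consts_le (d := d) L hL1 (ha0 k) (hb0 k) (hac k) (hbc k)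
    exact ⟨h.2.2.2.2.2.2.2.2.1, h.2.2.2.2.2.2.2.2.2.1, h.2.2.1, h.2.2.2.1⟩
  have F8 := fun (a : ℕ → ℝ) (ha0 : ∀ k, 0 ≤ a k) (hac : ∀ k, (((L ^ k : ℕ)) : ℝ) ^ 2 * a k ≤ c) (k : ℕ) =>
    oneMin_taxi_decay (d := d) L hL hd ha0 hb0 hac hbc hsm1 hsm7 hθ0 hθ1 hθL hCf0 hCf0' hCf0 hCf0' (key a ha0 hac k).1 (by norm_num : (0 : ℝ) ≤ 136)
      (key a ha0 hac k).2.2.1 hCRv0 k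
  refine ⟨fun a ha0 hac k => ((F8 a ha0 hac k).2.2.1).trans hsmV, fun k => ?_, fun a ha0 hac k => ?_, fun a ha0 hac k => (F8 a ha0 hac k).2.2.2.2.2.2.2⟩
  · have h := (F8 (fun _ => 0) (fun _ => le_rfl) (fun k => by rw [mul_zero]; exact hc0) k).2.2.2.1
    exact h.trans hsmG
  · have hmono := oneMinConst_mono (d := d) (L := L) (CP := 136) (CRv := CRv) (c := c) (key a ha0 hac k).1 (key a ha0 hac k).2.1 (key a ha0 hac k).2.2.1
      (key a ha0 hac k).2.2.2 (by norm_num) hCf0 hCf0' hCf0 hCf0' hc0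
    exact ((F8 a ha0 hac k).2.2.2.2.2.1).trans (mul_le_mul_of_nonneg_right hmono (pow_nonneg hθ0.le k))

/-! ## §3 The EXISTENCE END from operator data -/

/-- **THE VECTOR TOWER LIMIT AT BAŁABAN's TAXI DATA FOR THE COVARIANT PROJECTED GAUGE FUNCTIONAL EXISTS — FROM OPERATOR DATA.**  leaf-04-g7's
`effV_tendsto_taxiTower_projG_centred_regular` (p241220) with its four displayed decay lines SUPPLIED by §2 at `s = t = u = u₂ = w := θ₀^k`, `θ₀ := (√L)⁻¹`;
DISPLAYED: the one-step bond data (unitary, plaquette class `(L^{k+1})²b_k ≤ c`, coherent), the regular presentation of `Rlev k` with its classes, NUMERIC smallness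
(`hsm1`–`hsm7`, `hsmV`, `hsmG`, `hsmallδ`, `hsmallQ`).  Conclusion verbatim p241220's. [folklore] -/
theorem effV_tendsto_taxiTower_projG_of_data (hL : 2 ≤ L) (hd : 1 ≤ d) (hM2 : ∀ μ, 1 < M μ)
    {R' : (k : ℕ) → Tor (fine L (fine (L ^ k) M)) → Fin d → (ℂ →L[ℂ] ℂ)} (hU : ∀ k x μ, R' k x μ ∈ unitary (ℂ →L[ℂ] ℂ)) {b : ℕ → ℝ} {c : ℝ}
    (hb : ∀ k x κ ι, ‖R' k x κ * R' k (x + unitVec (fine L (fine (L ^ k) M)) κ) ι - R' k x ι * R' k (x + unitVec (fine L (fine (L ^ k) M)) ι) κ‖ ≤ b k)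
    (hb0 : ∀ k, 0 ≤ b k) (hbc : ∀ k, (((L ^ (k + 1) : ℕ)) : ℝ) ^ 2 * b k ≤ c)
    (hcoh : ∀ k, coarseTv L (fine (L ^ (k + 1)) M) (R' (k + 1)) = Rtrv (L ^ k) L M (R' k))
    -- the polynomial smallness of the class constant (part 2's four + two more)
    (hsm1 : 60 * (6 : ℝ) ^ (d - 1) * ((2 * ((((d - 1 : ℕ) : ℝ) + (d : ℝ) * d)) + 3 * ((d - 1 : ℕ) : ℝ)) * c) ≤ 1 / 2)
    (hsm2 : 2 * (d : ℝ) * ((((d - 1 : ℕ) : ℝ)) * c) ^ 2 ≤ 1 / 2) (hsm3 : 64 * (2 * ((((d - 1 : ℕ) : ℝ) + (d : ℝ) * d) * c)) ^ 2 ≤ 1)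
    (hsm4 : 80 * ((d : ℝ) * c) ≤ 1) (hsm5 : 64 * (d : ℝ) * ((((d - 1 : ℕ) : ℝ)) * c) ^ 2 ≤ 1 / 2)
    (hsm6 : 60 * (6 : ℝ) ^ (d - 1) * ((2 * ((((d - 1 : ℕ) : ℝ) + (d : ℝ) * d)) + 5 * ((d - 1 : ℕ) : ℝ)) * c) < 1)
    -- the DISPLAYED regular presentation of the tower's unit-lattice bond fields and the two numeric lines replacing (GF3) (part 7's letters)
    {ar ℓr : ℕ → ℝ} {α lam : ℝ} (har0 : ∀ k, 0 ≤ ar k) (har : ∀ k x μ, ‖Rlev L M R' k x μ - 1‖ ≤ ar k)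
    (hℓr : ∀ k x μ, ‖Rlev L M R' k x μ - Rlev L M R' k (x - unitVec (fine (L ^ k) M) μ) μ‖ ≤ ℓr k)
    (hα : ∀ k, (((L ^ k : ℕ)) : ℝ) * ar k ≤ α) (hlam : ∀ k, (((L ^ k : ℕ)) : ℝ) ^ 2 * ℓr k ≤ lam)
    (hsmallδ : (18 * (d * ((d + 1 : ℝ) * Cst d 1)) + 6) * deltaGap d 1 α lam (d * α) (((d - 1 : ℕ) : ℝ) * c) ^ 2 ≤ 1 / 2)
    (hsmallQ : ((d + 1 : ℝ) * Cst d 1) * (7 * (d * α ^ 2) + 2 * (2 * ((((d - 1 : ℕ) : ℝ) + (d : ℝ) * d) * c) + (d * α + α)) ^ 2) ≤ 1 / 2)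
    -- the effective-operator parameter
    {aa : ℝ} (haa : 0 < aa)
    -- file 6's `hcF` line and the two (ONE-min) transfer smallness lines (`v ≤ ⅛`, `γ ≤ ¼` under the class; polynomial in `c`)
    (hsm7 : 60 * (6 : ℝ) ^ (d - 1) * ((2 * ((((d - 1 : ℕ) : ℝ)) + (d : ℝ) * d) + 5 * ((d - 1 : ℕ) : ℝ)) * c) ≤ 1 / 2)
    (hsmV : (2 * ((4 * ((d : ℝ) * ((d : ℝ) * c)) * (4 * d * (36 : ℝ) ^ d * (1 + 3 * ((d - 1 : ℕ) : ℝ) * L * c) ^ 2)) ^ 2 * ((d : ℝ) * ((2 * (1 + (36 * (d * ((d + 1 : ℝ) * Cst d 1)) + 8))) + (2 * ((24 * (d * ((d + 1 : ℝ) * Cst d 1)) + 4) + d * c * 64)))))) ≤ 1 / 8)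
    (hsmG : ((3 * (((d - 1 : ℕ) : ℝ) * c)) ^ 2 * (max (40 * (2 * (1 + (36 * (d * ((d + 1 : ℝ) * Cst d 1)) + 8)))) (64 + 40 * (2 * ((24 * (d * ((d + 1 : ℝ) * Cst d 1)) + 4) + d * c * 64))))) ≤ 1 / 4) :
    ∃ Xlim : Matrix (Tor M × Fin d) (Tor M × Fin d) ℂ,
      Tendsto (fun k => effV (L ^ k) M (Rlev L M R' k)
        (GmProj (fine (L ^ k) M) (Rlev L M R' k) (LinearMap.ker (avgOp (L ^ k) M (taxiTv (L ^ k) M (Rlev L M R' k))))) (QmL (L ^ k) M (nestLv L M R' k)) aa)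
        atTop (𝓝 Xlim) ∧ Xlim.IsHermitian ∧ (∀ v, 0 ≤ qform Xlim v) ∧
      ∀ φ : Tor M → Fin d → ℂ, Tendsto (fun k => blockSpin (QvL (L ^ k) M (nestLv L M R' k))
        (ScV (L ^ k) M (Rlev L M R' k) (projG (fine (L ^ k) M) (Rlev L M R' k) (LinearMap.ker (avgOp (L ^ k) M (taxiTv (L ^ k) M (Rlev L M R' k)))))) φ)
        atTop (𝓝 (qform Xlim (unc φ))) := by
  -- the rate `θ₀ := (√L)⁻¹`: `0 < θ₀ < 1`, `θ₀² = L⁻¹`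
  have hL1 : (1 : ℝ) < L := by exact_mod_cast (lt_of_lt_of_le (by norm_num) hL : 1 < L)
  have hsq1 : 1 < Real.sqrt L := by simpa using Real.sqrt_lt_sqrt zero_le_one hL1
  have hsq0 : 0 < Real.sqrt L := lt_trans zero_lt_one hsq1
  have hθ0 : 0 < (Real.sqrt L)⁻¹ := inv_pos.mpr hsq0
  have hθ1 : (Real.sqrt L)⁻¹ < 1 := inv_lt_one_of_one_lt₀ hsq1
  have hθL : (L : ℝ)⁻¹ ≤ ((Real.sqrt L)⁻¹) ^ 2 := by
    rw [inv_pow, Real.sq_sqrt (le_of_lt (lt_trans zero_lt_one hL1))]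
  obtain ⟨hv, hγ, hε, hδ⟩ := centred_decay_lines (d := d) L hL hd hb0 hbc hsm1 hsm7 hsmV hsmG hθ0 hθL hθ1.le
  exact effV_tendsto_taxiTower_projG_centred_regular L M hL hd hM2 hU hb hb0 hbc hcoh hsm1 hsm2 hsm3 hsm4 hsm5 hsm6 har0 har hℓr hα hlam hsmallδ hsmallQ
    haa hθ0.le hθ1 (fun k => ((Real.sqrt L)⁻¹) ^ k) (fun k => ((Real.sqrt L)⁻¹) ^ k) (fun k => ((Real.sqrt L)⁻¹) ^ k) (fun k => ((Real.sqrt L)⁻¹) ^ k)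
    (fun k => ((Real.sqrt L)⁻¹) ^ k) (fun k => pow_pos hθ0 k) (fun k => pow_pos hθ0 k) (fun k => pow_pos hθ0 k) (fun k => pow_pos hθ0 k) (fun k => pow_pos hθ0 k)
    hv hγ hε hδ

end Taxi

end Summit.QuantumFields.BalabanUV.T4Continuum.VariationalColourTaxiTowerCentredEndData

end
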